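import Literature.NumberTheory.EllipticCurves.RankinSelbergBaseChangeHeckeValueProofs
import Literature.NumberTheory.GaloisRepresentations.AdmissibleModulusGalois
import Literature.NumberTheory.GaloisRepresentations.UnramifiedLocalNorms
import Literature.NumberTheory.GaloisRepresentations.IdelicLocalNorm
import Literature.NumberTheory.GaloisRepresentations.GlobalArtinMapBlockNormProofs
import Literature.NumberTheory.Automorphic.PairLFunctionMeromorphicContinuationNeConjRatProofs
import HarnessLib

/-!
# `ψ_θ ∘ N_{K/ℚ}` at the bad primes: ramification above `p ∣ cond θ`, and the value at a place
# over `p ∤ cond θ` without any unramifiedness hypothesis on `K`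

Topic `NumberTheory/EllipticCurves` (namespace `Literature.NumberTheory.EllipticCurves`; the
general Hecke-character lemmas carry the prefix `HeckeCharacter.`). Everything here is PROVED
(theorems only; no definitions, no named facts).

Fourth step of the discharge of
`Literature.NumberTheory.EllipticCurves.rankinSelbergEulerProductHecke_baseChangeDirichlet_eq`: the
two local evaluations left open by `RankinSelbergBaseChangeHeckeValueProofs.lean`.

* `HeckeCharacter.map_eq_one_of_mem_localUnitIdeles` — a Hecke character of `E` unramified at every
  place above `v` kills `∏_{w ∣ v} 𝒰_w ⊆ J_E`.
* `HeckeCharacter.isUnramifiedAt_of_compRelNorm` — **descent of unramifiedness along the norm at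
  a prime unramified in `E/F`**: if `ω ∘ N_{E/F}` is unramified at every `w ∣ v` and `v` is
  unramified in `E`, then `ω` is unramified at `v` — every unit of `𝒪_v` is a norm from
  `∏_{w ∣ v} 𝒪_wˣ` (the tree's `SemiLocal.exists_unitGroup_norm_eq_algebraMap_of_isUnramifiedIn`,
  Childress Lemma 5.3 (a)), transported to ideles by `IdeleHerbrand.ofBlock` exactly as in
  `localUnits_mem_idelicNormSubgroup_of_norm_eq_algebraMap`.
* `HeckeCharacter.compRelNorm_smul`, `…_isUnramifiedAt_of_smul`, `…_of_under_eq` — `ω ∘ N` is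
  `Gal(E/F)`-invariant, so its ramification is constant along the places over `v`.
* `not_isUnramifiedAt_compRelNorm_ofDirichlet`, `heckeValueExtZero_compRelNorm_ofDirichlet_of_dvd`
  — for `θ` PRIMITIVE mod `m`, `p ∣ m` unramified in `K`: `ψ_θ ∘ N` is ramified at every `w ∣ p`,
  so its extended-by-zero value there is `0 = θ(p)^{f_w}`.
* `compRelNorm_ofDirichlet_valueAtUniformizer` — for ANY prime `p ∤ m` (ramified in `K` or not)
  and `w ∣ p`: `(ψ_θ ∘ N)(ϖ_w) = θ(p)^{f_w}`, by evaluating `ψ_θ ∘ N` on the block idele of a global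
  `b ∈ Kˣ` with `ord_w b = 1`, `ord_{w'} b = 0` (`w' ∣ p`, `w' ≠ w`):
  `N(∏_{w'} ⟨b⟩_{w'}) = ⟨N b⟩_p` (`ideleRelNorm_blockIdele`) and `ord_p N b = f_w`
  (`log_valuation_norm`).

## References

* [CasselsFrohlichANT1967] Cassels–Fröhlich, *Algebraic Number Theory* (1967), Ch. VII (Tate)
  §§1.1, 2, 6.3.
* [Childress2009] N. Childress, *Class Field Theory* (2009), Ch. 4 §5 Lemma 5.3 (a).
* [NeukirchANT1999] J. Neukirch, *Algebraic Number Theory* (1999), Ch. VII (6.9) (conductor of a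
  Dirichlet/Hecke character).
* [Gross2004] B. H. Gross, *Heegner points and representation theory*, MSRI Publ. 49 (2004), §3.
-/

noncomputable section

open scoped MatrixGroups ModularForm NumberTheorySymbols Valued
open Module NumberField Ideal IsDedekindDomain CongruenceSubgroup Rat.HeightOneSpectrum
open Literature.NumberTheory.GaloisRepresentations Literature.NumberTheory.Automorphic IdeleHerbrand
open Literature.NumberTheory.EllipticCurves.ModularForms

/-! ### General lemmas on `ω ∘ N_{E/F}` -/

namespace Literature.NumberTheory.GaloisRepresentations

section General

variable {F E : Type} [Field F] [Field E] [Algebra F E] [NumberField F] [NumberField E]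

/-- A Hecke character of `E` unramified at every place above `v` kills `∏_{w ∣ v} 𝒰_w ⊆ J_E`
(decompose into the finitely many local ideles `⟨x_w⟩_w`). [cite: CasselsFrohlichANT1967, Ch. VII §1.1] -/
theorem HeckeCharacter.map_eq_one_of_mem_localUnitIdeles (χ : HeckeCharacter E)
    {v : HeightOneSpectrum (𝓞 F)}
    (hunr : ∀ w : HeightOneSpectrum (𝓞 E), w.under (𝓞 F) = v → χ.IsUnramifiedAt w)
    {x : ideleGroup E} (hx : x ∈ localUnitIdeles F E v) : χ x = 1 := by
  classical
  let c : ∀ q : HeightOneSpectrum (𝓞 E), (q.adicCompletion E)ˣ := fun q =>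
    Units.mk0 ((x : AdeleRing (𝓞 E) E).2 q) (ideleGroup_snd_ne_zero x q)
  set T : Finset (HeightOneSpectrum (𝓞 E)) := placesOverFinset F E v with hT
  have hdec : x = ∏ q ∈ T, localUnits q (c q) := by
    apply Units.ext
    refine Prod.ext ?_ (FiniteAdeleRing.ext E fun q => ?_)
    · rw [hx.1, fst_prod_localUnits]
    · rw [snd_prod_localUnits]
      split_ifs with hq
      · rfl
      · exact hx.2.1 q (fun h => hq (mem_placesOverFinset.2 h))
  rw [hdec, map_prod]
  refine Finset.prod_eq_one fun q hq => ?_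
  exact (hunr q (mem_placesOverFinset.1 hq)).map_localUnits_eq_one (c q) (hx.2.2 q)

variable [IsGalois F E]

/-- **Descent of unramifiedness along the norm at a prime unramified in `E/F`.** If `v` is
unramified in `E` and `ω ∘ N_{E/F}` is unramified at every place `w ∣ v`, then `ω` is unramified at
`v`: every unit `u` of `𝒪_v` is, diagonally, the norm of some `y ∈ ∏_{w ∣ v} 𝒪_wˣ` (Childress,
Lemma 5.3 (a)), so `⟨u⟩_v = N_{E/F}(y)` for the idele `y` (`IdeleHerbrand.ofBlock`) and
`ω(⟨u⟩_v) = (ω ∘ N)(y) = 1`. [cite: Childress2009, Ch. 4 §5 Lemma 5.3 (a) (PDF p. 95)] -/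
theorem HeckeCharacter.isUnramifiedAt_of_compRelNorm (ω : HeckeCharacter F)
    {v : HeightOneSpectrum (𝓞 F)} (hunrE : Algebra.IsUnramifiedIn (𝓞 E) v.asIdeal)
    (h : ∀ w : HeightOneSpectrum (𝓞 E), w.under (𝓞 F) = v → (ω.compRelNorm E).IsUnramifiedAt w) :
    ω.IsUnramifiedAt v := by
  intro u
  set U : (v.adicCompletion F)ˣ := Units.map ((v.adicCompletionIntegers F).subtype : _ →* _) u
    with hU
  have hU1 : Valued.v (U : v.adicCompletion F) = 1 := valued_coe_units_adicCompletionIntegers u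
  obtain ⟨y, hy, hNy⟩ :=
    SemiLocal.exists_unitGroup_norm_eq_algebraMap_of_isUnramifiedIn (E := E) hunrE hU1
  -- the idele `Y = ofBlock y` has norm `⟨U⟩_v`
  set X := AdeleRing.ideleBaseChange F E (localUnits v U) with hXdef
  have hX : X ∈ localUnitIdeles F E v := ideleBaseChange_localUnits_mem_localUnitIdeles E v hU1
  set Y : ideleGroup E := ofBlock y hy with hYdef
  have hNY : Herbrand.norm (E ≃ₐ[F] E) Y ∈ localUnitIdeles F E v :=
    isStable_localUnitIdeles.norm_mem (ofBlock_mem y hy)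
  have hblk : blockHom F E v (Herbrand.norm (E ≃ₐ[F] E) Y) = blockHom F E v X := by
    apply Units.ext
    rw [blockHom_norm, hYdef, blockHom_ofBlock, hNy, hXdef, coe_blockHom_ideleBaseChange_localUnits]
  have heq : Herbrand.norm (E ≃ₐ[F] E) Y = X := by
    have hmem : Herbrand.norm (E ≃ₐ[F] E) Y * X⁻¹ ∈ localUnitIdeles F E v ⊓ (blockHom F E v).ker := by
      refine Subgroup.mem_inf.mpr
        ⟨(localUnitIdeles F E v).mul_mem hNY ((localUnitIdeles F E v).inv_mem hX), ?_⟩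
      show Herbrand.norm (E ≃ₐ[F] E) Y * X⁻¹ ∈ (blockHom F E v).ker
      rw [MonoidHom.mem_ker, map_mul, map_inv, hblk, mul_inv_cancel]
    rw [localUnitIdeles_inf_ker_blockHom, Subgroup.mem_bot] at hmem
    exact mul_inv_eq_one.mp hmem
  have hrel : AdeleRing.ideleRelNorm F E Y = localUnits v U := by
    rw [AdeleRing.ideleRelNorm_eq_iff, ← hXdef, ← heq, Herbrand.norm_apply]
    rfl
  rw [HeckeCharacter.localComponent_apply, ← hrel, ← HeckeCharacter.compRelNorm_apply]
  exact HeckeCharacter.map_eq_one_of_mem_localUnitIdeles _ h (ofBlock_mem y hy)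

/-- **`ω ∘ N_{E/F}` is `Gal(E/F)`-invariant**: `N(σ • x) = N(x)`. [cite: CasselsFrohlichANT1967, Ch. VII §1.1] -/
theorem HeckeCharacter.compRelNorm_smul (ω : HeckeCharacter F) (σ : E ≃ₐ[F] E) (x : ideleGroup E) :
    ω.compRelNorm E (σ • x) = ω.compRelNorm E x := by
  have hN : AdeleRing.ideleGalNorm F E (σ • x) = AdeleRing.ideleGalNorm F E x := by
    rw [AdeleRing.ideleGalNorm_apply, AdeleRing.ideleGalNorm_apply]
    exact Fintype.prod_equiv (Equiv.mulRight σ) _ _ fun τ => by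
      rw [Equiv.coe_mulRight, mul_smul]
  have hrel : AdeleRing.ideleRelNorm F E (σ • x) = AdeleRing.ideleRelNorm F E x := by
    rw [AdeleRing.ideleRelNorm_eq_iff, AdeleRing.ideleBaseChange_ideleRelNorm, hN]
  rw [HeckeCharacter.compRelNorm_apply, HeckeCharacter.compRelNorm_apply, hrel]

/-- Ramification of `ω ∘ N_{E/F}` is constant on Galois orbits of places: unramified at `σ • w`
implies unramified at `w`. [cite: CasselsFrohlichANT1967, Ch. VII §1.1] -/
theorem HeckeCharacter.compRelNorm_isUnramifiedAt_of_smul (ω : HeckeCharacter F)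
    {w : HeightOneSpectrum (𝓞 E)} (σ : E ≃ₐ[F] E) (h : (ω.compRelNorm E).IsUnramifiedAt (σ • w)) :
    (ω.compRelNorm E).IsUnramifiedAt w := by
  intro u
  set U : (w.adicCompletion E)ˣ := Units.map ((w.adicCompletionIntegers E).subtype : _ →* _) u
    with hU
  have hU1 : Valued.v (U : w.adicCompletion E) = 1 := valued_coe_units_adicCompletionIntegers u
  rw [HeckeCharacter.localComponent_apply, ← HeckeCharacter.compRelNorm_smul ω σ,
    algEquiv_smul_localUnits (K := F) (L := E) σ w U]
  exact h.map_localUnits_eq_one _ (by rw [valued_galAdicCompletionUnitsEquiv]; exact hU1)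

/-- Ramification of `ω ∘ N_{E/F}` is the same at all places over a given place of `F`
(`Gal(E/F)` is transitive on them). [cite: CasselsFrohlichANT1967, Ch. VII Prop. 1.2 (ii)] -/
theorem HeckeCharacter.compRelNorm_isUnramifiedAt_of_under_eq (ω : HeckeCharacter F)
    {w w' : HeightOneSpectrum (𝓞 E)} (hww' : w.under (𝓞 F) = w'.under (𝓞 F))
    (h : (ω.compRelNorm E).IsUnramifiedAt w') : (ω.compRelNorm E).IsUnramifiedAt w := by
  obtain ⟨σ, hσ⟩ := HeightOneSpectrum.exists_algEquiv_smul_eq (F := F) hww'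
  exact ω.compRelNorm_isUnramifiedAt_of_smul σ (by rw [hσ]; exact h)

/-- **`ω` ramified at `v` unramified in `E/F` ⟹ `ω ∘ N_{E/F}` ramified at EVERY place over `v`.**
[cite: Childress2009, Ch. 4 §5 Lemma 5.3 (a) (PDF p. 95)] -/
theorem HeckeCharacter.not_isUnramifiedAt_compRelNorm (ω : HeckeCharacter F)
    {v : HeightOneSpectrum (𝓞 F)} (hunrE : Algebra.IsUnramifiedIn (𝓞 E) v.asIdeal)
    (hω : ¬ ω.IsUnramifiedAt v) {w : HeightOneSpectrum (𝓞 E)} (hw : w.under (𝓞 F) = v) :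
    ¬ (ω.compRelNorm E).IsUnramifiedAt w := fun h =>
  hω (ω.isUnramifiedAt_of_compRelNorm hunrE fun w' hw' =>
    ω.compRelNorm_isUnramifiedAt_of_under_eq (by rw [hw, hw']) h)

end General

end Literature.NumberTheory.GaloisRepresentations

namespace Literature.NumberTheory.EllipticCurves

/-! ### `ψ_θ ∘ N_{K/ℚ}` above the primes dividing the conductor -/

section Conductor

variable (K : Type) [Field K] [NumberField K] [IsGalois ℚ K] {m : ℕ} [NeZero m]

/-- **`ψ_θ ∘ N_{K/ℚ}` is ramified above every `p ∣ cond θ` unramified in `K`.** For a PRIMITIVE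
Dirichlet character `θ` mod `m`, a prime `p ∣ m` unramified in `K` and a place `w ∣ p` of `K`,
`ψ_θ ∘ N_{K/ℚ}` is ramified at `w` (`ψ_θ` is ramified at `p`, Neukirch VII (6.9), and
unramifiedness descends along the norm at an unramified prime).
[cite: NeukirchANT1999, Ch. VII Prop. (6.9)] [cite: Childress2009, Ch. 4 §5 Lemma 5.3 (a) (PDF p. 95)] -/
theorem not_isUnramifiedAt_compRelNorm_ofDirichlet {θ : DirichletCharacter ℂ m}
    (hprim : θ.IsPrimitive) {p : ℕ} (hp : p.Prime) (hpm : p ∣ m)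
    (hK : Algebra.IsUnramifiedIn (𝓞 K) (span {(p : ℤ)}))
    {w : HeightOneSpectrum (𝓞 K)} (hw : w.asIdeal ∈ primesOver (span {(p : ℤ)}) (𝓞 K)) :
    ¬ ((HeckeCharacter.ofDirichlet θ).compRelNorm K).IsUnramifiedAt w := by
  have hpw : (p : 𝓞 K) ∈ w.asIdeal := natCast_mem_of_mem_primesOver K hw
  set u : HeightOneSpectrum (𝓞 ℚ) := w.under (𝓞 ℚ) with hu
  have hgen : natGenerator u = p := natGenerator_under_eq_of_natCast_mem w hp hpw
  have hpu : ((p : ℕ) : 𝓞 ℚ) ∈ u.asIdeal := by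
    change algebraMap (𝓞 ℚ) (𝓞 K) (p : 𝓞 ℚ) ∈ w.asIdeal
    rwa [map_natCast]
  have hunrK : Algebra.IsUnramifiedIn (𝓞 K) u.asIdeal :=
    isUnramifiedIn_of_isUnramifiedIn_span hp hK u hpu
  let q₀ : m.primeFactors := ⟨p, Nat.mem_primeFactors.2 ⟨hp, hpm, NeZero.ne m⟩⟩
  have huq : u = Rat.placeOfFactor m q₀ :=
    Rat.natGenerator_injective (by rw [hgen, Rat.natGenerator_placeOfFactor])
  have hθ : ¬ (HeckeCharacter.ofDirichlet θ).IsUnramifiedAt u := by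
    rw [huq]
    exact HeckeCharacter.not_isUnramifiedAt_ofDirichlet hprim q₀
  exact (HeckeCharacter.ofDirichlet θ).not_isUnramifiedAt_compRelNorm hunrK hθ hu.symm

/-- The extended-by-zero Hecke value of `ψ_θ ∘ N_{K/ℚ}` (`θ` primitive mod `m`) at a place over
`p ∣ m`, `p` unramified in `K`, is `0 = θ(p)^{f_w}`. [cite: NeukirchANT1999, Ch. VII Prop. (6.9)]
[cite: Gross2004, §3 (p. 40)] -/
theorem heckeValueExtZero_compRelNorm_ofDirichlet_of_dvd {θ : DirichletCharacter ℂ m}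
    (hprim : θ.IsPrimitive) {p : ℕ} (hp : p.Prime) (hpm : p ∣ m)
    (hK : Algebra.IsUnramifiedIn (𝓞 K) (span {(p : ℤ)}))
    {w : HeightOneSpectrum (𝓞 K)} (hw : w.asIdeal ∈ primesOver (span {(p : ℤ)}) (𝓞 K)) :
    heckeValueExtZero ((HeckeCharacter.ofDirichlet θ).compRelNorm K) w =
      θ p ^ (absNorm w.asIdeal).factorization p := by
  haveI := hw.2
  haveI : (span {(p : ℤ)}).IsMaximal :=
    ((span_singleton_prime (by exact_mod_cast hp.ne_zero)).mpr
      (Nat.prime_iff_prime_int.mp hp)).isMaximal (by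
        rw [Ne, span_singleton_eq_bot]; exact_mod_cast hp.ne_zero)
  have hθp : θ (p : ZMod m) = 0 := by
    refine θ.map_nonunit (fun hunit => ?_)
    have hcop := (ZMod.isUnit_iff_coprime p m).mp hunit
    exact hp.one_lt.ne' (Nat.Coprime.eq_one_of_dvd hcop hpm)
  have hf : (absNorm w.asIdeal).factorization p ≠ 0 := by
    rw [absNorm_eq_pow_inertiaDeg' w.asIdeal hp, Nat.factorization_pow, Finsupp.smul_apply,
      hp.factorization_self, smul_eq_mul, mul_one]
    exact (inertiaDeg'_pos (span {(p : ℤ)}) w.asIdeal).ne'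
  rw [heckeValueExtZero_of_not_isUnramifiedAt
    (not_isUnramifiedAt_compRelNorm_ofDirichlet K hprim hp hpm hK hw), hθp, zero_pow hf]

end Conductor

/-! ### `ψ_θ ∘ N_{K/ℚ}` at a place over `p ∤ m`, no unramifiedness hypothesis on `K` -/

section Value

variable (K : Type) [Field K] [NumberField K] [IsGalois ℚ K] {m : ℕ} [NeZero m]

/-- **`(ψ_θ ∘ N_{K/ℚ})(ϖ_w) = θ(p)^{f_w}` at every place `w ∣ p`, `p ∤ m`** (`K/ℚ` Galois; `p` may
ramify in `K`). Choose `b ∈ Kˣ` with `ord_w b = 1` and `ord_{w'} b = 0` at the other places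
`w' ∣ p`; the block idele `X = ∏_{w' ∣ p} ⟨b⟩_{w'}` has `(ψ_θ ∘ N)(X) = (ψ_θ ∘ N)(⟨b⟩_w)` (the other
factors are local units, killed since `ψ_θ ∘ N` is unramified above `p ∤ m`), which is the value at
a uniformizer; and `N(X) = ⟨N b⟩_p` with `ord_p N b = f_w`, so that value is `ψ_θ(ϖ_p)^{f_w} =
θ(p)^{f_w}`. [cite: CasselsFrohlichANT1967, Ch. VII §2 and §6.3] [cite: Gross2004, §3 (p. 40)] -/
theorem compRelNorm_ofDirichlet_valueAtUniformizer (θ : DirichletCharacter ℂ m) {p : ℕ}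
    (hp : p.Prime) (hpm : ¬ p ∣ m)
    {w : HeightOneSpectrum (𝓞 K)} (hw : w.asIdeal ∈ primesOver (span {(p : ℤ)}) (𝓞 K)) :
    ((HeckeCharacter.ofDirichlet θ).compRelNorm K).IsUnramifiedAt w ∧
      ((HeckeCharacter.ofDirichlet θ).compRelNorm K).valueAtUniformizer w =
        θ p ^ (absNorm w.asIdeal).factorization p := by
  classical
  set ψ := HeckeCharacter.ofDirichlet θ with hψ
  set φ := ψ.compRelNorm K with hφ
  have hpw : (p : 𝓞 K) ∈ w.asIdeal := natCast_mem_of_mem_primesOver K hw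
  set u : HeightOneSpectrum (𝓞 ℚ) := w.under (𝓞 ℚ) with hu
  haveI : w.asIdeal.LiesOver u.asIdeal := ⟨rfl⟩
  haveI : u.asIdeal.IsMaximal := u.isPrime.isMaximal u.ne_bot
  haveI : w.asIdeal.IsMaximal := w.isPrime.isMaximal w.ne_bot
  have hgen : natGenerator u = p := natGenerator_under_eq_of_natCast_mem w hp hpw
  have hum : ¬ natGenerator u ∣ m := by rw [hgen]; exact hpm
  have hψu : ψ.IsUnramifiedAt u := HeckeCharacter.isUnramifiedAt_ofDirichlet θ hum
  have hunr : ∀ w' : HeightOneSpectrum (𝓞 K), w'.under (𝓞 ℚ) = u → φ.IsUnramifiedAt w' :=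
    fun w' hw' => ψ.compRelNorm_isUnramifiedAt (by rw [hw']; exact hψu)
  refine ⟨hunr w rfl, ?_⟩
  -- a global `b` with `ord_w b = 1`, `ord_{w'} b = 0` (`w' ∣ p`, `w' ≠ w`)
  have hwT : w ∈ placesOverFinset ℚ K u := mem_placesOverFinset.2 rfl
  obtain ⟨b, hb1, hb2⟩ := exists_units_valuation_eq_exp_neg_one (K := ℚ) (N := K) hwT
  -- `φ(X) = φ(⟨b⟩_w) = φ(ϖ_w)`
  have hXw : φ (blockIdele ℚ K u b) = φ (localUnits w (unitsToCompletion K w b)) := by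
    rw [blockIdele_apply, map_prod]
    refine Finset.prod_eq_single_of_mem w hwT fun w' hw' hne => ?_
    refine (hunr w' (mem_placesOverFinset.1 hw')).map_localUnits_eq_one _ ?_
    rw [coe_unitsToCompletion, HeightOneSpectrum.valuedAdicCompletion_eq_valuation']
    exact hb2 w' hw' hne
  have hval : ((φ (blockIdele ℚ K u b) : ℂˣ) : ℂ) = φ.valueAtUniformizer w := by
    rw [hXw, ← HeckeCharacter.localComponent_apply]
    refine HeckeCharacter.localComponent_eq_valueAtUniformizer (hunr w rfl) ?_
    rw [coe_unitsToCompletion, HeightOneSpectrum.valuedAdicCompletion_eq_valuation']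
    exact hb1
  -- `φ(X) = ψ(⟨N b⟩_p) = ψ(ϖ_p)^{f_w}`
  set f : ℕ := w.asIdeal.inertiaDeg (𝓞 ℚ) with hfdef
  have hord : Valued.v ((unitsToCompletion ℚ u (Units.map (Algebra.norm ℚ : K →* ℚ) b) :
      (u.adicCompletion ℚ)ˣ) : u.adicCompletion ℚ) = WithZero.exp (-(f : ℤ)) := by
    rw [coe_unitsToCompletion, HeightOneSpectrum.valuedAdicCompletion_eq_valuation', Units.coe_map]
    have hlog := log_valuation_norm (K := ℚ) (N := K) b u
    rw [Finset.sum_eq_single_of_mem w hwT (fun w' hw' hne => by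
      rw [hb2 w' hw' hne, WithZero.log_one, mul_zero]), hb1, WithZero.log_exp, mul_neg, mul_one]
      at hlog
    have hne : u.valuation ℚ (Algebra.norm ℚ (b : K)) ≠ 0 :=
      (Valuation.ne_zero_iff _).2 (Algebra.norm_ne_zero_iff.2 b.ne_zero)
    rw [← WithZero.exp_log hne, hlog]
  have hval' : ((φ (blockIdele ℚ K u b) : ℂˣ) : ℂ) = ψ.valueAtUniformizer u ^ (f : ℤ) := by
    rw [hφ, HeckeCharacter.compRelNorm_apply, ideleRelNorm_blockIdele ℚ K u b]
    exact hψu.coe_map_localUnits_eq_zpow _ hord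
  -- `N(w) = p^{f_w}`
  have hf : (absNorm w.asIdeal).factorization p = f := by
    rw [hfdef, ← Ideal.inertiaDeg'_eq_inertiaDeg u.asIdeal w.asIdeal,
      Ideal.absNorm_eq_pow_inertiaDeg'_of_liesOver w.asIdeal u.asIdeal u.isPrime u.ne_bot,
      Rat.absNorm_asIdeal_eq_natGenerator', hgen, Nat.factorization_pow, Finsupp.smul_apply,
      hp.factorization_self, smul_eq_mul, mul_one]
  rw [← hval, hval', zpow_natCast, hf, hψ, HeckeCharacter.valueAtUniformizer_ofDirichlet θ hum,
    Rat.residueCard_eq_natGenerator, hgen]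

/-- The extended-by-zero Hecke value of `ψ_θ ∘ N_{K/ℚ}` at any place over `p ∤ m` is
`θ(p)^{f_w}`. [cite: Gross2004, §3 (p. 40)] -/
theorem heckeValueExtZero_compRelNorm_ofDirichlet_of_not_dvd_level (θ : DirichletCharacter ℂ m)
    {p : ℕ} (hp : p.Prime) (hpm : ¬ p ∣ m)
    {w : HeightOneSpectrum (𝓞 K)} (hw : w.asIdeal ∈ primesOver (span {(p : ℤ)}) (𝓞 K)) :
    heckeValueExtZero ((HeckeCharacter.ofDirichlet θ).compRelNorm K) w =
      θ p ^ (absNorm w.asIdeal).factorization p := by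
  obtain ⟨hunr, hval⟩ := compRelNorm_ofDirichlet_valueAtUniformizer K θ hp hpm hw
  rw [heckeValueExtZero_of_isUnramifiedAt hunr, hval]

end Value

end Literature.NumberTheory.EllipticCurves

end
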